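import Literature.NumberTheory.NumberFields.UnramifiedElementaryCoinvariantModP
import Literature.NumberTheory.NumberFields.HilbertClassFieldCentralModP
import Literature.NumberTheory.NumberFields.HilbertClassFieldMaximal
import Literature.NumberTheory.NumberFields.InertiaGeneratesGalois
import HarnessLib

/-!
# GENUS CYCLICITY: for `L/K` cyclic of `p`-power degree with `p ∤ h_K` and at most TWO ramified primes, one of them totally ramified,
# the `Gal(L/K)`-coinvariants of `Cl(L)/p` are cyclic — `[Cl(L) : Cl(L)^p · ⟨σc·c⁻¹⟩] ≤ p`

Topic `NumberTheory/NumberFields` (namespace = path).  THEOREM-ONLY file (no definition, no named fact, no instance, no `sorry`), written by the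
prover seat `bsd-line-att-p3` g49 (cell `bsd-f1-sign2`, route `AlignedTransportAtTwo`; `--supports` stmt-BirchSwinnertonDyer-22298, closes nothing).
It DISCHARGES the displayed hypothesis `hcoinv` of this seat's coinvariant-form relation door (`IwasawaTheory/ClassGroupPRankLeOfRelationCoinvariant.lean`)
over the cell's bases (`h_K` odd, `2 = 𝔭₁𝔭₂` totally ramified in the cyclotomic `ℤ₂`-tower), for EVERY `2`-adic unit depth `t`.

THE THEOREM (`relIndex_pow_sup_closure_le_of_two_ramified`).  `L/K` Galois with cyclic group of order `p^n`, unramified at the infinite places,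
`p ∤ h_K`; every maximal ideal of `𝓞_L` not above `𝔭₁` or `𝔭₂` unramified over `K`; the primes above `𝔭₁` have ramification index `[L:K]`.  THEN
**`[Cl(𝓞 L) : Cl^p · ⟨σc·c⁻¹ : σ ∈ Gal(L/K), c⟩] ≤ p`**.
PROOF (genus theory through the Hilbert class field `H` of `L` and the EQUIVARIANT Artin isomorphism, all in the tree): in `Γ = Gal(H/K)` let `A = Gal(H/L)`
(`≅ Cl(L)`), `C = Artin(Cl^p⟨σc c⁻¹⟩) ≤ A`.  (1) `⁅Γ, A⁆ ≤ C` (equivariance: `τ̃ (H/L, c) τ̃⁻¹ = (H/L, τ̄c)`), hence `⁅Γ, Γ⁆ ≤ C` (`Γ/A` cyclic, `A/C` central in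
`Γ/C`).  (2) The fixed field of `N = C ⊔ ⨆_𝔔 I(𝔔)` is abelian over `K`, unramified at all places and of `p`-power degree, hence `= K` (`p ∤ h_K`, Cox 5.24):
`N = Γ`; conjugate inertia groups agree modulo `⁅Γ,Γ⁆ ≤ C`, unramified primes have trivial inertia, so `Γ = C ⊔ I₁ ⊔ I₂`.  (3) `I_i ∩ A = 1` (`H/L` unramified),
`#I₁ = e(𝔔₁|𝔭₁) = [L:K] = [Γ:A]`, `I₂ ↪ Γ/A` cyclic.  (4) Group theory (`relIndex_le_of_genus_data`): `B = C ⊔ I₁` has `[B:C] = #I₁`, `Γ/B` is cyclic (image of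
`I₂`) of exponent `p` (`Γ = A·I₁`, `A^p ≤ C`), so `[A:C] = [Γ:B] ≤ p`.

HONEST SCOPE: classical genus theory at finite level (Chevalley–Herbrand / Furtwängler; Washington §13.3 Lemma 13.15 in Iwasawa-theoretic language); nothing specific to
any summit; no certificate for any field is asserted; BSD is not advanced by this file.

References: [Gras2003] G. Gras, *Class Field Theory*, IV.4 (genus theory); [Washington1997] §13.3 Lemma 13.15, Prop. 13.22; [NeukirchANT1999] Ch. IV §6,
Ch. VI §6 Prop. (6.9), §7 Thm. (7.1); [Cox2013] §5.C Cor. 5.24, §8.A Thm. 8.10; [Lang1990] Ch. 13 §4.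
-/

set_option autoImplicit false

noncomputable section

open scoped NumberField commutatorElement Pointwise
open NumberField IsDedekindDomain Field IntermediateField

namespace Literature.NumberTheory.NumberFields

/-! ## §1 Group theory: the genus datum forces `[A : C] ≤ p` -/

section Group

variable {Γ : Type*} [Group Γ] [Finite Γ]

omit [Finite Γ] in
/-- A subgroup containing the commutator subgroup is normal. [folklore] -/
private theorem normal_of_commutator_le {C : Subgroup Γ} (h : ⁅(⊤ : Subgroup Γ), (⊤ : Subgroup Γ)⁆ ≤ C) : C.Normal :=
  ⟨fun n hn g => by
    have h1 : g * n * g⁻¹ = ⁅g, n⁆ * n := by rw [commutatorElement_def]; group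
    rw [h1]
    exact mul_mem (h (Subgroup.commutator_mem_commutator (Subgroup.mem_top g) (Subgroup.mem_top n))) hn⟩

/-- **The genus datum.**  `Γ` finite, `C ≤ A ≤ Γ` with `⁅Γ,Γ⁆ ≤ C` and `a^p ∈ C` for `a ∈ A`; `I₁, I₂ ≤ Γ` with `I₁ ∩ A = I₂ ∩ A = 1`, `#I₁ = [Γ : A]`,
`I₂` cyclic, and `C ⊔ I₁ ⊔ I₂ = Γ`.  THEN `[A : C] ≤ p` (`Γ = A·I₁`, `B = C·I₁`, `Γ/B` cyclic of exponent `p`, `[A:C] = [Γ:B]`).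
[cite: Gras2003, IV.4 (genus theory)] [cite: Washington1997, §13.3 Lemma 13.15] -/
theorem relIndex_le_of_genus_data {p : ℕ} (hp : p.Prime) (C A I₁ I₂ : Subgroup Γ) (hcomm : ⁅(⊤ : Subgroup Γ), (⊤ : Subgroup Γ)⁆ ≤ C)
    (hCA : C ≤ A) (hexp : ∀ a ∈ A, a ^ p ∈ C) (hI₁A : I₁ ⊓ A = ⊥) (hcard₁ : Nat.card I₁ = A.index)
    (hI₂ : IsCyclic I₂) (hgen : C ⊔ I₁ ⊔ I₂ = ⊤) :
    C.relIndex A ≤ p := by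
  classical
  haveI hCn : C.Normal := normal_of_commutator_le hcomm
  haveI hAn : A.Normal := normal_of_commutator_le (hcomm.trans hCA)
  set B : Subgroup Γ := C ⊔ I₁ with hB
  haveI hBn : B.Normal := normal_of_commutator_le (hcomm.trans le_sup_left)
  -- `Γ = A ⊔ I₁`
  have hAI : A ⊔ I₁ = ⊤ := by
    rw [← Subgroup.index_eq_one, ← Nat.dvd_one]
    have h1 : (A ⊔ I₁).index ∣ A.index := Subgroup.index_dvd_of_le le_sup_left
    have h2 : (A ⊔ I₁).index ∣ I₁.index := Subgroup.index_dvd_of_le le_sup_right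
    -- `#I₁ · [Γ : I₁] = #Γ = #A · [Γ : A] = #A · #I₁`, so `[Γ:I₁] = #A`, coprime considerations are not needed: use the product formula
    have h3 : A.relIndex (A ⊔ I₁) * (A ⊔ I₁).index = A.index := Subgroup.relIndex_mul_index le_sup_left
    have h4 : A.relIndex (A ⊔ I₁) = A.relIndex I₁ := Subgroup.relIndex_sup_left (H := I₁) (K := A)
    have h5 : A.relIndex I₁ = Nat.card I₁ := by
      rw [Subgroup.relIndex, show A.subgroupOf I₁ = ⊥ from ?_, Subgroup.index_bot]
      rw [eq_bot_iff]
      intro x hx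
      have : (x : Γ) ∈ I₁ ⊓ A := ⟨x.2, hx⟩
      rw [hI₁A, Subgroup.mem_bot] at this
      exact Subtype.ext this
    rw [h4, h5, hcard₁] at h3
    have hpos : 0 < A.index := Nat.pos_of_ne_zero Subgroup.index_ne_zero_of_finite
    exact ⟨1, by nlinarith [h3]⟩
  -- `Γ/B` has exponent `p`
  have hexpB : ∀ x : Γ ⧸ B, x ^ p = 1 := by
    intro x
    induction x using QuotientGroup.induction_on with
    | H g =>
      have hg : g ∈ A ⊔ I₁ := by rw [hAI]; exact Subgroup.mem_top g
      rw [Subgroup.mem_sup_of_normal_left] at hg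
      obtain ⟨a, ha, i, hi, rfl⟩ := hg
      rw [← QuotientGroup.mk_pow, QuotientGroup.eq_one_iff]
      have hmk : (QuotientGroup.mk (s := B) (a * i) : Γ ⧸ B) = QuotientGroup.mk a := by
        rw [QuotientGroup.mk_mul, (QuotientGroup.eq_one_iff i).mpr (Subgroup.mem_sup_right hi : i ∈ B), mul_one]
      rw [← QuotientGroup.eq_one_iff, QuotientGroup.mk_pow, hmk, ← QuotientGroup.mk_pow, QuotientGroup.eq_one_iff]
      exact Subgroup.mem_sup_left (hexp a ha)
  -- `Γ/B` is cyclic: `I₂ ↠ Γ/B`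
  have hsurj : Function.Surjective ((QuotientGroup.mk' B).comp I₂.subtype) := by
    intro x
    induction x using QuotientGroup.induction_on with
    | H g =>
      have hg : g ∈ B ⊔ I₂ := by rw [hB, hgen]; exact Subgroup.mem_top g
      rw [Subgroup.mem_sup_of_normal_left] at hg
      obtain ⟨b, hb, i, hi, rfl⟩ := hg
      refine ⟨⟨i, hi⟩, ?_⟩
      rw [MonoidHom.comp_apply, Subgroup.subtype_apply, QuotientGroup.mk'_apply, QuotientGroup.mk_mul,
        (QuotientGroup.eq_one_iff b).mpr hb, one_mul]
  haveI : IsCyclic (Γ ⧸ B) := isCyclic_of_surjective _ hsurj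
  -- hence `[Γ : B] ∣ p`
  have hBidx : B.index ≤ p := by
    obtain ⟨g, hg⟩ := IsCyclic.exists_generator (α := Γ ⧸ B)
    have hord : orderOf g = Nat.card (Γ ⧸ B) := orderOf_eq_card_of_forall_mem_zpowers hg
    have hdvd : orderOf g ∣ p := orderOf_dvd_of_pow_eq_one (hexpB g)
    rw [Subgroup.index, ← hord]
    exact Nat.le_of_dvd hp.pos hdvd
  -- `[A : C] = [Γ : B]`
  have h1 : C.relIndex A * A.index = C.index := Subgroup.relIndex_mul_index hCA
  have h2 : C.relIndex B * B.index = C.index := Subgroup.relIndex_mul_index le_sup_left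
  have h3 : C.relIndex B = Nat.card I₁ := by
    rw [hB, Subgroup.relIndex_sup_left (H := I₁) (K := C)]
    rw [Subgroup.relIndex, show C.subgroupOf I₁ = ⊥ from ?_, Subgroup.index_bot]
    rw [eq_bot_iff]
    intro x hx
    have : (x : Γ) ∈ I₁ ⊓ A := ⟨x.2, hCA hx⟩
    rw [hI₁A, Subgroup.mem_bot] at this
    exact Subtype.ext this
  rw [h3, hcard₁] at h2
  have hpos : 0 < A.index := Nat.pos_of_ne_zero Subgroup.index_ne_zero_of_finite
  have hAC : C.relIndex A = B.index := by
    have := h1.trans h2.symm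
    rw [mul_comm (A.index)] at this
    exact Nat.eq_of_mul_eq_mul_right hpos this
  rw [hAC]
  exact hBidx

end Group

/-! ## §1b Inertia groups along an injection of Galois groups -/

section Inertia

variable {H : Type*} [Field H] [NumberField H] {Γ Γ' : Type*} [Group Γ] [Group Γ'] [MulSemiringAction Γ H] [MulSemiringAction Γ' H]

omit [NumberField H] in
/-- For `f : Γ ↪ Γ'` compatible with the actions on `𝓞 H`, `#I_Γ(Q) = #(I_{Γ'}(Q) ⊓ f(Γ))` (Serre, *Local Fields*, I §7 Prop. 22 a)). [folklore] -/
private theorem card_inertia_eq_card_inf_range' (Q : Ideal (𝓞 H)) (f : Γ →* Γ') (hinj : Function.Injective f)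
    (hf : ∀ (γ : Γ) (x : 𝓞 H), f γ • x = γ • x) :
    Nat.card (Q.inertia Γ) = Nat.card (Q.inertia Γ' ⊓ f.range : Subgroup Γ') := by
  refine Nat.card_congr (Equiv.ofBijective
    (fun γ => ⟨f γ, fun x => by rw [hf]; exact γ.2 x, γ.1, rfl⟩) ⟨?_, ?_⟩)
  · intro a b h
    exact Subtype.ext (hinj (congrArg (fun t : ↥(Q.inertia Γ' ⊓ f.range) => (t : Γ')) h))
  · rintro ⟨g, hgI, γ, rfl⟩
    exact ⟨⟨γ, fun x => by rw [← hf]; exact hgI x⟩, rfl⟩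

end Inertia

/-! ## §2 The genus theorem -/

section Main

variable {K L : Type} [Field K] [NumberField K] [Field L] [NumberField L] [Algebra K L] [IsGalois K L]
  [IsUnramifiedAtInfinitePlaces K L]

set_option maxHeartbeats 3200000 in
set_option synthInstance.maxHeartbeats 400000 in
/-- ★★★ **GENUS CYCLICITY.**  `L/K` Galois with CYCLIC group of order `p^n`, unramified at the infinite places, **`p ∤ h_K`**; maximal ideals `P₁, P₂` of `𝓞_K`
such that every maximal ideal of `𝓞_L` above neither is unramified over `K`, and every maximal ideal above `P₁` has ramification index `[L:K]` (total
ramification).  THEN **`[Cl(𝓞 L) : Cl(𝓞 L)^p · ⟨σc·c⁻¹ : σ ∈ Gal(L/K), c⟩] ≤ p`**: the `Gal(L/K)`-coinvariants of `Cl(L)/p` are cyclic.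
[cite: Gras2003, IV.4 (genus theory)] [cite: Washington1997, §13.3 Lemma 13.15 and Prop. 13.22] [cite: NeukirchANT1999, Ch. VI §7 Thm. (7.1), §6 Prop. (6.9)]
[cite: Cox2013, §5.C Cor. 5.24] -/
theorem index_pow_sup_closure_le_of_two_ramified {p : ℕ} [hp : Fact p.Prime] (hcyc : IsCyclic (L ≃ₐ[K] L))
    (hdegp : ∃ n : ℕ, Module.finrank K L = p ^ n) (hh : ¬ p ∣ Fintype.card (ClassGroup (𝓞 K)))
    (P₁ P₂ : Ideal (𝓞 K)) [P₁.IsMaximal] [P₂.IsMaximal]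
    (hram : ∀ (q : Ideal (𝓞 L)) [q.IsMaximal], q.under (𝓞 K) ≠ P₁ → q.under (𝓞 K) ≠ P₂ → Algebra.IsUnramifiedAt (𝓞 K) q)
    (htot : ∀ (q : Ideal (𝓞 L)) [q.IsMaximal], q.under (𝓞 K) = P₁ → q.ramificationIdx (𝓞 K) = Module.finrank K L) :
    ((powMonoidHom p : ClassGroup (𝓞 L) →* ClassGroup (𝓞 L)).range ⊔
      Subgroup.closure {x | ∃ (σ : L ≃ₐ[K] L) (c : ClassGroup (𝓞 L)),
        x = ClassGroup.mulEquiv (AmbiguousClass.intAut σ) c * c⁻¹}).index ≤ p := by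
  classical
  -- ### §0 the Hilbert class field `H` of `L`, Galois over `K`; `ρ : Gal(H/L) → Gal(H/K)`
  haveI : IsScalarTower K L (hilbertClassField L) :=
    IsScalarTower.of_algebraMap_eq fun x => Subtype.ext (IsScalarTower.algebraMap_apply K L (AlgebraicClosure L) x)
  haveI : IsGalois K (hilbertClassField L) := hilbertClassField.isGalois_of_isGalois L
  haveI : IsUnramifiedAtInfinitePlaces K (hilbertClassField L) :=
    IsUnramifiedAtInfinitePlaces.trans K L (hilbertClassField L)
  let ρ : (hilbertClassField L ≃ₐ[L] hilbertClassField L) →* (hilbertClassField L ≃ₐ[K] hilbertClassField L) :=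
    { toFun := fun a => a.restrictScalars K
      map_one' := rfl
      map_mul' := fun _ _ => rfl }
  have hρ : ∀ a y, ρ a y = a y := fun _ _ => rfl
  have hρinj : Function.Injective ρ := fun a b h => AlgEquiv.restrictScalars_injective K h
  -- the restriction `π : Gal(H/K) → Gal(L/K)` and its kernel `A = ρ(Gal(H/L))`
  set π : (hilbertClassField L ≃ₐ[K] hilbertClassField L) →* (L ≃ₐ[K] L) := AlgEquiv.restrictNormalHom L with hπ
  have hπ_apply : ∀ (τ : hilbertClassField L ≃ₐ[K] hilbertClassField L) (x : L),
      algebraMap L (hilbertClassField L) (π τ x) = τ (algebraMap L (hilbertClassField L) x) := fun τ x =>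
    AlgEquiv.restrictNormal_commutes τ L x
  set A : Subgroup (hilbertClassField L ≃ₐ[K] hilbertClassField L) := ρ.range with hA
  have hkerπ : π.ker = A := by
    ext τ
    rw [MonoidHom.mem_ker]
    constructor
    · intro h1
      have hfix : ∀ x : L, τ (algebraMap L (hilbertClassField L) x) = algebraMap L (hilbertClassField L) x := fun x => by
        rw [← hπ_apply, h1, AlgEquiv.one_apply]
      exact ⟨AlgEquiv.ofRingEquiv (f := τ.toRingEquiv) hfix, AlgEquiv.ext fun y => rfl⟩
    · rintro ⟨a, rfl⟩
      apply AlgEquiv.ext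
      intro x
      apply (algebraMap L (hilbertClassField L)).injective
      rw [hπ_apply, hρ, AlgEquiv.commutes, AlgEquiv.one_apply]
  have hπsurj : Function.Surjective π := AlgEquiv.restrictNormalHom_surjective (hilbertClassField L)
  haveI hAn : A.Normal := by rw [← hkerπ]; infer_instance
  have hAidx : A.index = Module.finrank K L := by
    rw [← hkerπ, Subgroup.index_ker, MonoidHom.range_eq_top.mpr hπsurj, Subgroup.card_top, IsGalois.card_aut_eq_finrank]
  haveI : IsCyclic ((hilbertClassField L ≃ₐ[K] hilbertClassField L) ⧸ π.ker) :=
    isCyclic_of_surjective _ (QuotientGroup.quotientKerEquivOfSurjective π hπsurj).symm.surjective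
  haveI : IsCyclic ((hilbertClassField L ≃ₐ[K] hilbertClassField L) ⧸ A) :=
    isCyclic_of_surjective _ (QuotientGroup.quotientMulEquivOfEq hkerπ).surjective
  -- ### §1 `S = Cl^p·⟨σc·c⁻¹⟩`, `C = Artin(S) ≤ Gal(H/L)`, `Ct = ρ(C)`
  set S : Subgroup (ClassGroup (𝓞 L)) := (powMonoidHom p : ClassGroup (𝓞 L) →* ClassGroup (𝓞 L)).range ⊔
      Subgroup.closure {x | ∃ (σ : L ≃ₐ[K] L) (c : ClassGroup (𝓞 L)), x = ClassGroup.mulEquiv (AmbiguousClass.intAut σ) c * c⁻¹} with hS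
  have hSσ : ∀ (σ : L ≃ₐ[K] L) (c : ClassGroup (𝓞 L)), ClassGroup.mulEquiv (AmbiguousClass.intAut σ) c * c⁻¹ ∈ S := fun σ c =>
    Subgroup.mem_sup_right (Subgroup.subset_closure ⟨σ, c, rfl⟩)
  have hSp : ∀ c : ClassGroup (𝓞 L), c ^ p ∈ S := fun c => Subgroup.mem_sup_left ⟨c, rfl⟩
  set C : Subgroup (hilbertClassField L ≃ₐ[L] hilbertClassField L) := S.map (hilbertClassField.artinEquiv L).toMonoidHom with hC
  set Ct : Subgroup (hilbertClassField L ≃ₐ[K] hilbertClassField L) := C.map ρ with hCt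
  have hCtA : Ct ≤ A := Subgroup.map_le_range ρ C
  have hmemCt : ∀ c : ClassGroup (𝓞 L), c ∈ S → ρ (hilbertClassField.artinEquiv L c) ∈ Ct := fun c hc =>
    ⟨_, ⟨c, hc, rfl⟩, rfl⟩
  -- `[A : Ct] = [Cl : S]`
  have hrel : Ct.relIndex A = S.index := by
    have h1 : Ct.comap ρ = C := by rw [hCt]; exact Subgroup.comap_map_eq_self_of_injective hρinj C
    have h2 : (Ct.comap ρ).index = Ct.relIndex ρ.range := Subgroup.index_comap Ct ρ
    rw [hA, ← h2, h1, hC]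
    refine Subgroup.index_map_eq S (hilbertClassField.artinEquiv L).surjective ?_
    intro x hx
    rw [MonoidHom.mem_ker] at hx
    have : x = 1 := (hilbertClassField.artinEquiv L).injective (by rw [map_one]; exact hx)
    rw [this]
    exact one_mem S
  have hexpA : ∀ a ∈ A, a ^ p ∈ Ct := by
    rintro _ ⟨b, rfl⟩
    set c : ClassGroup (𝓞 L) := (hilbertClassField.artinEquiv L).symm b with hcdef
    have hc : hilbertClassField.artinEquiv L c = b := (hilbertClassField.artinEquiv L).apply_symm_apply b
    rw [← map_pow, ← hc, ← map_pow]
    exact hmemCt _ (hSp c)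
  -- ### §2 `⁅Γ, A⁆ ≤ Ct` (equivariant Artin) and `⁅Γ, Γ⁆ ≤ Ct`
  have hcommA : ⁅(⊤ : Subgroup (hilbertClassField L ≃ₐ[K] hilbertClassField L)), A⁆ ≤ Ct := by
    rw [Subgroup.commutator_le]
    intro τ _ b hb
    obtain ⟨a, rfl⟩ := MonoidHom.mem_range.mp hb
    have hτ : ∀ x : L, τ (algebraMap L (hilbertClassField L) x) =
        algebraMap L (hilbertClassField L) (τ.restrictNormal L x) := fun x => (AlgEquiv.restrictNormal_commutes τ L x).symm
    obtain ⟨a', ha'⟩ := hilbertClassField.exists_algEquiv_conj L τ (τ.restrictNormal L) hτ a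
    set c : ClassGroup (𝓞 L) := (hilbertClassField.artinEquiv L).symm a with hcdef
    have hc : hilbertClassField.artinEquiv L c = a := (hilbertClassField.artinEquiv L).apply_symm_apply a
    have key : hilbertClassField.artinEquiv L (ClassGroup.mulEquiv (AmbiguousClass.intAut (τ.restrictNormal L)) c) = a' :=
      AlgEquiv.ext fun y => (hilbertClassField.artinEquiv_mulEquiv_intAut_apply L τ (τ.restrictNormal L) hτ c y).trans
        (by rw [hc, ha'])
    have hconj : τ * ρ a * τ⁻¹ = ρ a' := by
      apply AlgEquiv.ext
      intro y
      rw [AlgEquiv.mul_apply, AlgEquiv.mul_apply, hρ, hρ, ha']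
      rfl
    have hcomm : ⁅τ, ρ a⁆ = ρ (a' * a⁻¹) := by
      rw [commutatorElement_def, hconj, map_mul, map_inv]
    rw [hcomm, ← key, ← hc, ← map_inv, ← map_mul]
    exact hmemCt _ (hSσ _ _)
  haveI hCtn : Ct.Normal := ⟨fun x hx g => by
    have h1 : g * x * g⁻¹ = ⁅g, x⁆ * x := by rw [commutatorElement_def]; group
    rw [h1]
    exact mul_mem (hcommA (Subgroup.commutator_mem_commutator (Subgroup.mem_top g) (hCtA hx))) hx⟩
  -- `Γ/Ct` is commutative: `A/Ct` is central (by `hcommA`) with cyclic quotient `Γ/A ≅ Gal(L/K)`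
  have hQcomm : ∀ a b : (hilbertClassField L ≃ₐ[K] hilbertClassField L) ⧸ Ct, a * b = b * a := by
    have hle : Ct ≤ π.ker := by rw [hkerπ]; exact hCtA
    let f : ((hilbertClassField L ≃ₐ[K] hilbertClassField L) ⧸ Ct) →* (L ≃ₐ[K] L) := QuotientGroup.lift Ct π hle
    have hf : f.ker ≤ Subgroup.center _ := by
      intro x hx
      induction x using QuotientGroup.induction_on with
      | H g =>
        rw [MonoidHom.mem_ker, QuotientGroup.lift_mk] at hx
        have hgA : g ∈ A := by rw [← hkerπ]; exact hx
        rw [Subgroup.mem_center_iff]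
        intro y
        induction y using QuotientGroup.induction_on with
        | H h =>
          rw [← QuotientGroup.mk_mul, ← QuotientGroup.mk_mul, QuotientGroup.eq]
          have h2 : (h * g)⁻¹ * (g * h) = ⁅g⁻¹, h⁻¹⁆ := by rw [commutatorElement_def]; group
          rw [h2, ← commutatorElement_inv]
          exact inv_mem (hcommA (Subgroup.commutator_mem_commutator (Subgroup.mem_top _) (inv_mem hgA)))
    haveI : IsCyclic (L ≃ₐ[K] L) := hcyc
    exact (f.isMulCommutative_of_isCyclic_of_ker_le_center hf).is_comm.comm
  haveI hQc : IsMulCommutative ((hilbertClassField L ≃ₐ[K] hilbertClassField L) ⧸ Ct) := ⟨⟨hQcomm⟩⟩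
  have hcommTop : ⁅(⊤ : Subgroup (hilbertClassField L ≃ₐ[K] hilbertClassField L)), ⊤⁆ ≤ Ct := by
    rw [← commutator_def, ← Subgroup.Normal.quotient_commutative_iff_commutator_le]
    exact hQc
  -- ### §3 inertia groups meet `A` trivially (`H/L` is unramified)
  have hIA : ∀ (𝔔 : Ideal (𝓞 (hilbertClassField L))) [𝔔.IsMaximal],
      𝔔.inertia (hilbertClassField L ≃ₐ[K] hilbertClassField L) ⊓ A = ⊥ := by
    intro 𝔔 _
    have hcardL : Nat.card (𝔔.inertia (hilbertClassField L ≃ₐ[L] hilbertClassField L)) = 1 := by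
      rw [card_inertia_eq_ramificationIdx (hilbertClassField L) (hilbertClassField L ≃ₐ[L] hilbertClassField L) L 𝔔]
      haveI := hilbertClassField.isUnramifiedAt L 𝔔
      exact Ideal.ramificationIdx_eq_one 𝔔 (𝓞 L)
    have hcmp := card_inertia_eq_card_inf_range' 𝔔 ρ hρinj (fun _ _ => rfl)
    rw [hcardL] at hcmp
    rw [hA]
    exact Subgroup.card_eq_one.mp hcmp.symm
  -- ### §4 `N = Ct ⊔ ⨆_𝔔 I(𝔔) = ⊤`: its fixed field is abelian, unramified everywhere, of `p`-power degree, and `p ∤ h_K`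
  -- `S.index`, hence `Ct.index`, is a power of `p`
  obtain ⟨n, hn⟩ := hdegp
  obtain ⟨j, hj⟩ : ∃ j : ℕ, S.index = p ^ j := by
    have hG : IsPGroup p (ClassGroup (𝓞 L) ⧸ S) := by
      intro x
      induction x using QuotientGroup.induction_on with
      | H c => exact ⟨1, by rw [pow_one, ← QuotientGroup.mk_pow, QuotientGroup.eq_one_iff]; exact hSp c⟩
    obtain ⟨j, hj⟩ := hG.exists_card_eq
    exact ⟨j, by rw [Subgroup.index, hj]⟩
  have hCtidx : Ct.index = p ^ (j + n) := by
    rw [← Subgroup.relIndex_mul_index hCtA, hrel, hAidx, hn, hj, pow_add]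
  have hN : Ct ⊔ (⨆ 𝔔 : MaximalSpectrum (𝓞 (hilbertClassField L)),
      𝔔.asIdeal.inertia (hilbertClassField L ≃ₐ[K] hilbertClassField L)) = ⊤ := by
    set N := Ct ⊔ (⨆ 𝔔 : MaximalSpectrum (𝓞 (hilbertClassField L)),
      𝔔.asIdeal.inertia (hilbertClassField L ≃ₐ[K] hilbertClassField L)) with hNdef
    haveI hNn : N.Normal := normal_of_commutator_le (hcommTop.trans le_sup_left)
    set F₀ : IntermediateField K (hilbertClassField L) := IntermediateField.fixedField N with hF₀
    haveI : IsGalois K F₀ := IsGalois.of_fixedField_normal_subgroup N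
    have hF₀deg : Module.finrank K F₀ = N.index := by
      have h1 := Module.finrank_mul_finrank K F₀ (hilbertClassField L)
      rw [hF₀, IntermediateField.finrank_fixedField_eq_card N] at h1
      have h2 : N.index * Nat.card N = Nat.card (hilbertClassField L ≃ₐ[K] hilbertClassField L) := N.index_mul_card
      rw [IsGalois.card_aut_eq_finrank] at h2
      rw [hF₀]
      exact Nat.eq_of_mul_eq_mul_right Nat.card_pos (h1.trans h2.symm)
    haveI : IsAbelianGalois K F₀ := by
      refine { is_comm := ⟨fun x y => ?_⟩ }
      obtain ⟨x', rfl⟩ := (IsGalois.normalAutEquivQuotient N).surjective x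
      obtain ⟨y', rfl⟩ := (IsGalois.normalAutEquivQuotient N).surjective y
      rw [← map_mul, ← map_mul]
      congr 1
      have hc : IsMulCommutative ((hilbertClassField L ≃ₐ[K] hilbertClassField L) ⧸ N) := by
        rw [Subgroup.Normal.quotient_commutative_iff_commutator_le, commutator_def]
        exact hcommTop.trans le_sup_left
      exact hc.is_comm.comm x' y'
    haveI : IsUnramifiedAtInfinitePlaces K F₀ :=
      IsUnramifiedAtInfinitePlaces.bot (k := K) (K := F₀) (F := hilbertClassField L)
    haveI : NumberField F₀ := NumberField.of_module_finite K F₀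
    have hunrF : ∀ v : HeightOneSpectrum (𝓞 K), Algebra.IsUnramifiedIn (𝓞 F₀) v.asIdeal := by
      intro v q hq hqv
      haveI := hq
      have hq0 : q ≠ ⊥ := by
        intro h0
        apply v.ne_bot
        rw [hqv.over, h0, Ideal.under_def, Ideal.comap_bot_of_injective _
          (FaithfulSMul.algebraMap_injective (𝓞 K) (𝓞 F₀))]
      haveI : q.IsMaximal := hq.isMaximal hq0
      obtain ⟨Q, hQmax, hQq⟩ := Ideal.exists_maximal_ideal_liesOver_of_isIntegral (S := 𝓞 (hilbertClassField L)) q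
      haveI := hQmax
      have hq' : q = Q.under (𝓞 F₀) := hQq.over
      subst hq'
      rw [isUnramifiedAt_under_iff_inertia_le' F₀ Q, hF₀, IntermediateField.fixingSubgroup_fixedField]
      exact (le_iSup (fun 𝔔 : MaximalSpectrum (𝓞 (hilbertClassField L)) =>
        𝔔.asIdeal.inertia (hilbertClassField L ≃ₐ[K] hilbertClassField L)) ⟨Q, hQmax⟩).trans le_sup_right
    -- a copy of `F₀` inside `K̄`
    haveI : Algebra.IsAlgebraic K F₀ := Algebra.IsAlgebraic.of_finite K F₀
    let ι₀ : F₀ →ₐ[K] AlgebraicClosure K := IsAlgClosed.lift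
    let F' : IntermediateField K (AlgebraicClosure K) := ι₀.fieldRange
    let e : F₀ ≃ₐ[K] F' := AlgEquiv.ofInjectiveField ι₀
    haveI : FiniteDimensional K F' := LinearEquiv.finiteDimensional e.toLinearEquiv
    haveI : IsAbelianGalois K F' := IsAbelianGalois.of_algHom e.symm.toAlgHom
    haveI : NumberField F' := NumberField.of_module_finite K F'
    haveI : IsUnramifiedAtInfinitePlaces K F' := isUnramifiedAtInfinitePlaces_of_algHom e.symm.toAlgHom
    have hunr' := forall_isUnramifiedIn_of_algHom e.symm.toAlgHom hunrF
    -- `[F₀ : K] ∣ [Γ : Ct] = p^(j+n)` is prime to `h_K`, so `F' = ⊥`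
    have hdvd : Module.finrank K F' ∣ p ^ (j + n) := by
      rw [← e.toLinearEquiv.finrank_eq, hF₀deg, ← hCtidx]
      exact Subgroup.index_dvd_of_le le_sup_left
    have hcop : Nat.Coprime (Module.finrank K F') (Fintype.card (ClassGroup (𝓞 K))) :=
      Nat.Coprime.coprime_dvd_left hdvd (Nat.Coprime.pow_left _ ((Nat.Prime.coprime_iff_not_dvd hp.out).mpr hh))
    have hbot : F' = ⊥ := hilbertClassField.eq_bot_of_coprime_classNumber K F' hunr' hcop
    have hdeg1 : Module.finrank K F₀ = 1 := by
      rw [e.toLinearEquiv.finrank_eq, hbot, IntermediateField.finrank_bot]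
    rw [hF₀deg, Subgroup.index_eq_one] at hdeg1
    exact hdeg1
  -- ### §5 two primes above `P₁`, `P₂`; every inertia group lies in `Ct ⊔ I₁ ⊔ I₂`
  obtain ⟨𝔔₁, h𝔔₁max, h𝔔₁⟩ := Ideal.exists_maximal_ideal_liesOver_of_isIntegral (S := 𝓞 (hilbertClassField L)) P₁
  obtain ⟨𝔔₂, h𝔔₂max, h𝔔₂⟩ := Ideal.exists_maximal_ideal_liesOver_of_isIntegral (S := 𝓞 (hilbertClassField L)) P₂
  haveI := h𝔔₁max
  haveI := h𝔔₂max
  haveI := h𝔔₁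
  haveI := h𝔔₂
  set I₁ := 𝔔₁.inertia (hilbertClassField L ≃ₐ[K] hilbertClassField L) with hI₁
  set I₂ := 𝔔₂.inertia (hilbertClassField L ≃ₐ[K] hilbertClassField L) with hI₂
  -- conjugates of an inertia group lie in `Ct ⊔ I`
  have hconjle : ∀ (I : Subgroup (hilbertClassField L ≃ₐ[K] hilbertClassField L)) (g : hilbertClassField L ≃ₐ[K] hilbertClassField L),
      I.map (MulAut.conj g).toMonoidHom ≤ Ct ⊔ I := by
    rintro I g _ ⟨y, hy, rfl⟩
    change g * y * g⁻¹ ∈ Ct ⊔ I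
    have h1 : g * y * g⁻¹ = ⁅g, y⁆ * y := by rw [commutatorElement_def]; group
    rw [h1]
    exact mul_mem (Subgroup.mem_sup_left (hcommTop (Subgroup.commutator_mem_commutator (Subgroup.mem_top g) (Subgroup.mem_top y))))
      (Subgroup.mem_sup_right hy)
  -- the ramification index of a prime of `𝓞_H` over `K` is that of the prime of `𝓞_L` below it
  have htower : ∀ (𝔔 : Ideal (𝓞 (hilbertClassField L))) [𝔔.IsMaximal],
      Nat.card (𝔔.inertia (hilbertClassField L ≃ₐ[K] hilbertClassField L)) = (𝔔.under (𝓞 L)).ramificationIdx (𝓞 K) := by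
    intro 𝔔 _
    haveI : (𝔔.under (𝓞 L)).IsMaximal := Ideal.IsMaximal.under (𝓞 L) 𝔔
    have ht := Ideal.ramificationIdx_tower (R := 𝓞 K) (𝔔.under (𝓞 L)) 𝔔
    haveI := hilbertClassField.isUnramifiedAt L 𝔔
    rw [Ideal.ramificationIdx_eq_one 𝔔 (𝓞 L), mul_one] at ht
    rw [card_inertia_eq_ramificationIdx (hilbertClassField L) (hilbertClassField L ≃ₐ[K] hilbertClassField L) K 𝔔, ht]
  have hgen : Ct ⊔ I₁ ⊔ I₂ = ⊤ := by
    rw [eq_top_iff, ← hN, sup_le_iff]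
    refine ⟨le_sup_left.trans le_sup_left, iSup_le fun 𝔔 => ?_⟩
    haveI := 𝔔.isMaximal
    by_cases h1 : 𝔔.asIdeal.under (𝓞 K) = P₁
    · haveI : 𝔔.asIdeal.LiesOver P₁ := ⟨h1.symm⟩
      obtain ⟨g, hg⟩ := Ideal.exists_smul_eq_of_isGaloisGroup P₁ 𝔔₁ 𝔔.asIdeal (hilbertClassField L ≃ₐ[K] hilbertClassField L)
      have hI := inertia_smul_eq_map_conj (hilbertClassField L) (hilbertClassField L ≃ₐ[K] hilbertClassField L) g 𝔔₁
      rw [hg] at hI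
      rw [hI]
      exact (hconjle I₁ g).trans le_sup_left
    by_cases h2 : 𝔔.asIdeal.under (𝓞 K) = P₂
    · haveI : 𝔔.asIdeal.LiesOver P₂ := ⟨h2.symm⟩
      obtain ⟨g, hg⟩ := Ideal.exists_smul_eq_of_isGaloisGroup P₂ 𝔔₂ 𝔔.asIdeal (hilbertClassField L ≃ₐ[K] hilbertClassField L)
      have hI := inertia_smul_eq_map_conj (hilbertClassField L) (hilbertClassField L ≃ₐ[K] hilbertClassField L) g 𝔔₂
      rw [hg] at hI
      rw [hI]
      exact (hconjle I₂ g).trans (sup_le (le_sup_left.trans le_sup_left) le_sup_right)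
    · -- unramified over `K`: trivial inertia
      have hq1 : (𝔔.asIdeal.under (𝓞 L)).under (𝓞 K) ≠ P₁ := by rwa [Ideal.under_under]
      have hq2 : (𝔔.asIdeal.under (𝓞 L)).under (𝓞 K) ≠ P₂ := by rwa [Ideal.under_under]
      haveI : (𝔔.asIdeal.under (𝓞 L)).IsMaximal := Ideal.IsMaximal.under (𝓞 L) 𝔔.asIdeal
      haveI := hram (𝔔.asIdeal.under (𝓞 L)) hq1 hq2
      have hcard : Nat.card (𝔔.asIdeal.inertia (hilbertClassField L ≃ₐ[K] hilbertClassField L)) = 1 := by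
        rw [htower, Ideal.ramificationIdx_eq_one (𝔔.asIdeal.under (𝓞 L)) (𝓞 K)]
      rw [Subgroup.card_eq_one.mp hcard]
      exact bot_le
  -- `#I₁ = e(𝔔₁ | K) = [L : K] = [Γ : A]`
  have hcard₁ : Nat.card I₁ = A.index := by
    haveI : (𝔔₁.under (𝓞 L)).IsMaximal := Ideal.IsMaximal.under (𝓞 L) 𝔔₁
    have hu : (𝔔₁.under (𝓞 L)).under (𝓞 K) = P₁ := by rw [Ideal.under_under]; exact h𝔔₁.over.symm
    rw [hI₁, htower, htot _ hu, hAidx]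
  -- `I₂` is cyclic: it embeds in `Γ/A ≅ Gal(L/K)`
  have hI₂cyc : IsCyclic I₂ := by
    let j₂ : I₂ →* (hilbertClassField L ≃ₐ[K] hilbertClassField L) ⧸ A := (QuotientGroup.mk' A).comp I₂.subtype
    have hj : Function.Injective j₂ := by
      intro x y hxy
      have h1 : (QuotientGroup.mk (s := A) ((x : I₂) : hilbertClassField L ≃ₐ[K] hilbertClassField L)) =
          QuotientGroup.mk (s := A) ((y : I₂) : hilbertClassField L ≃ₐ[K] hilbertClassField L) := hxy
      rw [QuotientGroup.eq] at h1
      have h2 : ((x : hilbertClassField L ≃ₐ[K] hilbertClassField L))⁻¹ * y ∈ I₂ ⊓ A :=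
        Subgroup.mem_inf.mpr ⟨I₂.mul_mem (I₂.inv_mem x.2) y.2, h1⟩
      rw [hIA 𝔔₂, Subgroup.mem_bot] at h2
      exact Subtype.ext (inv_mul_eq_one.mp h2)
    exact isCyclic_of_surjective (MonoidHom.ofInjective hj).symm.toMonoidHom (MonoidHom.ofInjective hj).symm.surjective
  -- ### §6 conclusion
  have h := relIndex_le_of_genus_data hp.out Ct A I₁ I₂ hcommTop hCtA hexpA (hIA 𝔔₁) hcard₁ hI₂cyc hgen
  rw [hrel] at h
  exact h

end Main

end Literature.NumberTheory.NumberFields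

end
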